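import Literature.Geometry.GaugeTheory.AdaptedFramesCanonicalTorsion
import Literature.Geometry.Kaehler.FormDerivativeVectorFields
import HarnessLib

/-!
# Almost Kähler manifolds are quasi-Kähler, in an adapted frame — and Taubes's Lemma 1
# (`dω = 0 ⇒ ∂_{A₀} u₀ = 0`), Čech form

Topic `Literature/Geometry/GaugeTheory`; continues `AdaptedFramesCanonicalTorsion` (for
`𝔞 : AdaptedFrames g o J ι`: Taubes's torsion `b`, the vector `w(v) = (∇_v J) e₀`
(`frameTorsionVec`), and `∂_{A₀} u₀ = 0` *given* the quasi-Kähler identity `w(Jv) = -J w(v)`), and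
uses the invariant formula for `d` of a `2`-form (`Kaehler/FormDerivativeVectorFields`,
`mextDeriv_two_apply_vectorField`).

**The classical fact.** For an almost Hermitian manifold `(M, g, J)` with Kähler form `Ω` and
Levi-Civita connection `∇`, `(∇_X Ω)(Y, Z) = g(Y, (∇_X J) Z)` and `3 dΩ = 𝔖 (∇_X Ω)(Y, Z)`
(cyclic sum); the class `AK` of almost Kähler manifolds (`dΩ = 0`) is contained in the class `QK`
of quasi-Kähler manifolds (`(∇_X J) Y + (∇_{JX} J) JY = 0`) — Gray–Hervella's `W₂ ⊂ W₁ ⊕ W₂`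
(Falcitelli–Ianus–Pastore 2004, §3.1, Tables 3.1–3.2 and the displayed formulas; A. Gray and
L. M. Hervella, Ann. Mat. Pura Appl. 123 (1980)).  The proof is pure linear algebra on the tensor
`A(X, Y, Z) = g((∇_X J) Y, Z)`: from `A(X, JY, JZ) = -A(X, Y, Z)` and `𝔖 A = 0` one gets that
`B(X, Y, Z) = A(X, Y, Z) + A(JX, JY, Z)` satisfies `B(X, Y, Z) = -B(Y, Z, X)`, whence `B = 0`.

**This file** runs that argument *in the indices of an adapted orthonormal frame*
`(e₀, e₁ = Je₀, e₂, e₃ = Je₂)` of a chart `U_i` of `𝔞`, where `J e_k = ε_k e_{κ(k)}` with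
`κ = (1 0 3 2)` (`jIdx`) and `ε = (1, -1, 1, -1)` (`jSgn`), and where the `2`-form `s` with
`s(v, w) = g(Jv, w)` has *constant coefficients* — so that in `ds(e_a, e_b, e_c)` (Warner's invariant
formula) only the bracket terms survive, and these are Levi-Civita terms by torsion-freeness:

* `covJCoeffOf κ ε Γ a b c = ε_b Γ_{a; κb, c} + ε_c Γ_{a; b, κc}` — the frame components
  `A(e_a, e_b, e_c) = g((∇_{e_a} J) e_b, e_c)` in terms of `Γ_{a;b,c} = g(∇_{e_a} e_b, e_c)`
  (`frameChristoffel`) — and the algebra: `covJCoeffOf_map_map` (`A(X,JY,JZ) = -A(X,Y,Z)`),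
  `covJCoeffOf_add_map_map` (**`𝔖 A = 0 ⇒ A(X,Y,Z) + A(JX,JY,Z) = 0`**), `covJCoeffOf_quasiKaehler`;
* `covJCoeffOf_frameChristoffel_cyclic`: **`ds = 0 ⇒ 𝔖 A(e_a, e_b, e_c) = 0`**;
* `frameTorsionVec_map_eq_neg_map`: **`dω = 0 ⇒ (∇_{Jv} J) e₀ = -J (∇_v J) e₀`** for all `v`
  (the hypothesis `hq` of `dirac_canonicalConnection_canonicalSpinor_eq_zero_of_quasiKaehler`), hence
* `dirac_canonicalConnection_canonicalSpinor_eq_zero_of_isClosedForm`: **Taubes's Lemma 1** (Math.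
  Res. Lett. 1 (1994), §1, p. 811: "The form `ω` is closed if and only if `u₀` solves the Dirac
  equation"), direction `⇒`: `∂_{A₀} u₀ = 0` on every chart, for Taubes's connection `A₀`.

PROVED, 0 named facts.

## References

* M. Falcitelli, S. Ianus, A. M. Pastore, *Riemannian Submersions and Related Topics*, World
  Scientific (2004), Ch. 3, §3.1 (Tables 3.1, 3.2; `3dΩ = 𝔖∇Ω`). [FalcitelliPastoreIanus2004]
* C. H. Taubes, *The Seiberg–Witten invariants and symplectic forms*, Math. Res. Lett. 1 (1994)
  809–822, §1, Lemma 1. [Taubes1994]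
* F. W. Warner, *Foundations of Differentiable Manifolds and Lie Groups* (1983), Prop. 2.25 (f).
  [Warner1983]
-/

noncomputable section

open scoped Manifold ContDiff Topology
open Set Function Filter VectorField Bundle
open Literature.Geometry.Lorentzian (PseudoRiemannianMetric)
open Literature.Topology.FourManifolds (SmoothOrientation)
open Literature.Geometry.Kaehler (MForm IsSmoothForm IsClosedForm mextDeriv)

namespace Literature.Geometry.GaugeTheory

/-- Local notation: the model space `ℝ⁴`. -/
local notation "𝔼⁴" => EuclideanSpace ℝ (Fin 4)

/-! ### Algebra: the index form of "almost Kähler ⇒ quasi-Kähler" -/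

section Algebra

variable {κ : Type*} {jI : κ → κ} {jS : κ → ℝ}

/-- **The frame components of `∇J`**: for "Christoffel symbols" `Γ a b c = g(∇_{e_a} e_b, e_c)` of a
frame with `J e_b = ε_b e_{κ b}`, the number `A(e_a, e_b, e_c) = g((∇_{e_a} J) e_b, e_c)
= g(∇_{e_a}(J e_b) - J ∇_{e_a} e_b, e_c) = ε_b Γ_{a; κb, c} + ε_c Γ_{a; b, κc}`
(using `g(Ju, e_c) = -ε_c g(u, e_{κc})`). [cite: FalcitelliPastoreIanus2004, Ch. 3 §3.1] -/
def covJCoeffOf (jI : κ → κ) (jS : κ → ℝ) (Γ : κ → κ → κ → ℝ) (a b c : κ) : ℝ :=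
  jS b * Γ a (jI b) c + jS c * Γ a b (jI c)

/-- **`A(X, JY, JZ) = -A(X, Y, Z)`** in frame indices: `ε_b ε_c A(a, κb, κc) = -A(a, b, c)`
(from `κ² = 1`, `ε ∘ κ = -ε`, `ε² = 1`; the identity `(∇_X J) J = -J (∇_X J)` and the `J`-invariance
of `g`). [cite: FalcitelliPastoreIanus2004, Ch. 3 §3.1] -/
theorem covJCoeffOf_map_map (hI : ∀ a, jI (jI a) = a) (hS : ∀ a, jS (jI a) = -jS a)
    (hS2 : ∀ a, jS a * jS a = 1) (Γ : κ → κ → κ → ℝ) (a b c : κ) :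
    jS b * jS c * covJCoeffOf jI jS Γ a (jI b) (jI c) = -covJCoeffOf jI jS Γ a b c := by
  simp only [covJCoeffOf, hI, hS]
  linear_combination (-(jS c) * Γ a b (jI c)) * hS2 b + (-(jS b) * Γ a (jI b) c) * hS2 c

/-- **`A(X, JY, Z) = A(X, Y, JZ)`** in frame indices: `ε_b A(a, κb, c) = ε_c A(a, b, κc)`.
[cite: FalcitelliPastoreIanus2004, Ch. 3 §3.1] -/
theorem covJCoeffOf_map_eq (hI : ∀ a, jI (jI a) = a) (hS : ∀ a, jS (jI a) = -jS a)
    (hS2 : ∀ a, jS a * jS a = 1) (Γ : κ → κ → κ → ℝ) (a b c : κ) :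
    jS b * covJCoeffOf jI jS Γ a (jI b) c = jS c * covJCoeffOf jI jS Γ a b (jI c) := by
  have h := covJCoeffOf_map_map hI hS hS2 Γ a b (jI c)
  rw [hI, hS] at h
  linear_combination (-(jS c)) * h - (jS b * covJCoeffOf jI jS Γ a (jI b) c) * hS2 c

/-- The anticyclicity of `B(a, b, c) = A(a, b, c) + ε_a ε_b A(κa, κb, c)` when `𝔖 A = 0`:
`B(a, b, c) + B(b, c, a) = 0`. [cite: FalcitelliPastoreIanus2004, Ch. 3 §3.1] -/
theorem covJCoeffOf_add_map_map_anticyclic (hI : ∀ a, jI (jI a) = a) (hS : ∀ a, jS (jI a) = -jS a)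
    (hS2 : ∀ a, jS a * jS a = 1) (Γ : κ → κ → κ → ℝ)
    (hiii : ∀ a b c, covJCoeffOf jI jS Γ a b c + covJCoeffOf jI jS Γ b c a + covJCoeffOf jI jS Γ c a b = 0)
    (a b c : κ) :
    (covJCoeffOf jI jS Γ a b c + jS a * jS b * covJCoeffOf jI jS Γ (jI a) (jI b) c) +
      (covJCoeffOf jI jS Γ b c a + jS b * jS c * covJCoeffOf jI jS Γ (jI b) (jI c) a) = 0 := by
  have h1 := covJCoeffOf_map_eq hI hS hS2 Γ (jI b) c a
  have hii := covJCoeffOf_map_map hI hS hS2 Γ c a b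
  linear_combination hiii a b c + (jS a * jS b) * hiii (jI a) (jI b) c - hii + jS b * h1

/-- **Almost Kähler ⇒ quasi-Kähler, index form** (Gray–Hervella `W₂ ⊂ W₁ ⊕ W₂`): if the frame
components `A` of `∇J` have vanishing cyclic sum (`dΩ = 0`), then
`A(a, b, c) + ε_a ε_b A(κa, κb, c) = 0`, i.e. `(∇_X J) Y + (∇_{JX} J) JY = 0` on frame vectors.
[cite: FalcitelliPastoreIanus2004, Ch. 3 §3.1, Tables 3.1–3.2] -/
theorem covJCoeffOf_add_map_map (hI : ∀ a, jI (jI a) = a) (hS : ∀ a, jS (jI a) = -jS a)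
    (hS2 : ∀ a, jS a * jS a = 1) (Γ : κ → κ → κ → ℝ)
    (hiii : ∀ a b c, covJCoeffOf jI jS Γ a b c + covJCoeffOf jI jS Γ b c a + covJCoeffOf jI jS Γ c a b = 0)
    (a b c : κ) :
    covJCoeffOf jI jS Γ a b c + jS a * jS b * covJCoeffOf jI jS Γ (jI a) (jI b) c = 0 := by
  have h₁ := covJCoeffOf_add_map_map_anticyclic hI hS hS2 Γ hiii a b c
  have h₂ := covJCoeffOf_add_map_map_anticyclic hI hS hS2 Γ hiii b c a
  have h₃ := covJCoeffOf_add_map_map_anticyclic hI hS hS2 Γ hiii c a b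
  linear_combination (h₁ - h₂ + h₃) / 2

/-- **The quasi-Kähler identity in the form used for Taubes's torsion**:
`ε_a A(κa, k, c) = ε_c A(a, k, κc)`, i.e. `g((∇_{J e_a} J) e_k, e_c) = g(-J (∇_{e_a} J) e_k, e_c)`.
[cite: FalcitelliPastoreIanus2004, Ch. 3 §3.1, Tables 3.1–3.2] -/
theorem covJCoeffOf_quasiKaehler (hI : ∀ a, jI (jI a) = a) (hS : ∀ a, jS (jI a) = -jS a)
    (hS2 : ∀ a, jS a * jS a = 1) (Γ : κ → κ → κ → ℝ)
    (hiii : ∀ a b c, covJCoeffOf jI jS Γ a b c + covJCoeffOf jI jS Γ b c a + covJCoeffOf jI jS Γ c a b = 0)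
    (a k c : κ) :
    jS a * covJCoeffOf jI jS Γ (jI a) k c = jS c * covJCoeffOf jI jS Γ a k (jI c) := by
  have hB := covJCoeffOf_add_map_map hI hS hS2 Γ hiii (jI a) k c
  rw [hI, hS] at hB
  have h1 := covJCoeffOf_map_eq hI hS hS2 Γ a k c
  linear_combination jS a * hB + h1 + (jS k * covJCoeffOf jI jS Γ a (jI k) c) * hS2 a

end Algebra

/-! ### The `J`-action on an adapted frame: `J e_k = ε_k e_{κ k}` -/

namespace AdaptedFrames

/-- The index permutation `κ = (1 0 3 2)` of the `J`-action on an adapted frame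
(`J e₀ = e₁`, `J e₁ = -e₀`, `J e₂ = e₃`, `J e₃ = -e₂`). [cite: MorganSWBook1996, §3.4] -/
def jIdx : Fin 4 → Fin 4 := ![1, 0, 3, 2]

/-- The signs `ε = (1, -1, 1, -1)` of the `J`-action on an adapted frame. [cite: MorganSWBook1996, §3.4] -/
def jSgn : Fin 4 → ℝ := ![1, -1, 1, -1]

/-- `κ` is an involution. [folklore] -/
@[simp] theorem jIdx_jIdx (a : Fin 4) : jIdx (jIdx a) = a := by
  fin_cases a <;> rfl

/-- `ε ∘ κ = -ε`. [folklore] -/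
@[simp] theorem jSgn_jIdx (a : Fin 4) : jSgn (jIdx a) = -jSgn a := by
  fin_cases a <;> simp [jSgn, jIdx]

/-- `ε² = 1`. [folklore] -/
@[simp] theorem jSgn_mul_self (a : Fin 4) : jSgn a * jSgn a = 1 := by
  fin_cases a <;> simp [jSgn]

/-- `κ 0 = 1`. [folklore] -/
@[simp] theorem jIdx_zero : jIdx 0 = 1 := rfl

/-- `ε 0 = 1`. [folklore] -/
@[simp] theorem jSgn_zero : jSgn 0 = 1 := rfl

section Bundle

variable {X : Type*} [TopologicalSpace X] [ChartedSpace 𝔼⁴ X] [IsManifold (𝓡 4) ∞ X]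
  {g : PseudoRiemannianMetric (𝓡 4) ∞ 𝔼⁴ (TangentSpace (𝓡 4) : X → Type _)}
  {o : SmoothOrientation (𝓡 4) X} {J : Π x : X, TangentSpace (𝓡 4) x →ₗ[ℝ] TangentSpace (𝓡 4) x}
  {ι : Type*} (𝔞 : AdaptedFrames g o J ι)

/-- **`J e_k = ε_k e_{κ k}`** on the chart `U_i` of an adapted frame. [cite: MorganSWBook1996, §3.4] -/
theorem map_frame (i : ι) {y : X} (hy : y ∈ 𝔞.baseSet i) (k : Fin 4) :
    J y (𝔞.frame i k y) = jSgn k • 𝔞.frame i (jIdx k) y := by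
  obtain ⟨h0, h1, h2, h3⟩ := 𝔞.isAdaptedFrame_frame i y hy
  fin_cases k
  · simpa [jSgn, jIdx] using h0
  · simpa [jSgn, jIdx] using h1
  · simpa [jSgn, jIdx] using h2
  · simpa [jSgn, jIdx] using h3

/-- `g(e_k, e_l) = δ_{kl}` on the chart. [folklore] -/
theorem val_frame_frame (i : ι) {y : X} (hy : y ∈ 𝔞.baseSet i) (k l : Fin 4) :
    g.val y (𝔞.frame i k y) (𝔞.frame i l y) = if k = l then 1 else 0 := by
  have he := 𝔞.isOrthonormalFrame_frame i hy
  by_cases h : k = l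
  · subst h
    rw [if_pos rfl]
    exact he.1 k
  · rw [if_neg h]
    exact he.2 k l h

/-- Two tangent vectors with the same pairings against the frame are equal. [folklore] -/
theorem eq_of_val_frame_eq (i : ι) {x : X} (hx : x ∈ 𝔞.baseSet i) {u w : TangentSpace (𝓡 4) x}
    (h : ∀ c, g.val x u (𝔞.frame i c x) = g.val x w (𝔞.frame i c x)) : u = w := by
  have he := 𝔞.isOrthonormalFrame_frame i hx
  rw [← sum_val_smul_frame_eq g he u, ← sum_val_smul_frame_eq g he w]
  simp only [h]

/-- **`g(Ju, e_c) = -ε_c g(u, e_{κ c})`**: `J` is `g`-skew, read in the adapted frame.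
[cite: MorganSWBook1996, §3.4] -/
theorem val_map_frame (i : ι) {x : X} (hx : x ∈ 𝔞.baseSet i) (u : TangentSpace (𝓡 4) x) (c : Fin 4) :
    g.val x (J x u) (𝔞.frame i c x) = -jSgn c * g.val x u (𝔞.frame i (jIdx c) x) := by
  have he := 𝔞.isOrthonormalFrame_frame i hx
  conv_lhs => rw [← sum_val_smul_frame_eq g he u]
  fin_cases c <;> simp [Fin.sum_univ_four, 𝔞.map_frame i hx, 𝔞.val_frame_frame i hx, jIdx, jSgn]

/-- The frame fields are differentiable at the points of their chart. [folklore] -/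
theorem mdifferentiableAt_frame (i : ι) (k : Fin 4) {y : X} (hy : y ∈ 𝔞.baseSet i) :
    MDifferentiableAt (𝓡 4) ((𝓡 4).prod 𝓘(ℝ, 𝔼⁴)) (fun x ↦ TotalSpace.mk' 𝔼⁴ x (𝔞.frame i k x)) y :=
  ((𝔞.contMDiffOn_frame i k).contMDiffAt ((𝔞.isOpen_baseSet i).mem_nhds hy)).mdifferentiableAt (by simp)

/-! ### The Levi-Civita "Christoffel symbols" of the frame and the components of `∇J` -/

section LC

variable [g.HasLeviCivita]

/-- **`Γ_{a; b, c} = g(∇_{e_a} e_b, e_c)`** (`= ω̃_{c,b}(e_a)`, `lcForm`), the Levi-Civita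
connection of `g` read in the frame of the chart `i` at `x`. [cite: MorganSWBook1996, §3.2] -/
def frameChristoffel (i : ι) (x : X) (a b c : Fin 4) : ℝ :=
  g.val x (g.leviCivita (𝔞.frame i b) x (𝔞.frame i a x)) (𝔞.frame i c x)

/-- Unfolding `frameChristoffel`. [folklore] -/
@[simp] theorem frameChristoffel_apply (i : ι) (x : X) (a b c : Fin 4) :
    𝔞.frameChristoffel i x a b c = g.val x (g.leviCivita (𝔞.frame i b) x (𝔞.frame i a x)) (𝔞.frame i c x) :=
  rfl

/-- **`g(∇_v e_k, e_l) = -g(∇_v e_l, e_k)`** on the chart: the Levi-Civita connection forms of an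
orthonormal frame are skew (metric compatibility on the constants `g(e_k, e_l)`; the tree's
`SpincStructure.isTwoForm_lcForm`). [cite: MorganSWBook1996, §3.2] -/
theorem val_leviCivita_frame_swap (i : ι) {x : X} (hx : x ∈ 𝔞.baseSet i) (v : TangentSpace (𝓡 4) x)
    (k l : Fin 4) :
    g.val x (g.leviCivita (𝔞.frame i k) x v) (𝔞.frame i l x) =
      -g.val x (g.leviCivita (𝔞.frame i l) x v) (𝔞.frame i k x) := by
  have h := 𝔞.toSpincStructure.isTwoForm_lcForm i hx v
  unfold IsTwoForm at h
  have h' := congrFun (congrFun h k) l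
  simp only [Matrix.transpose_apply, Matrix.neg_apply, SpincStructure.lcForm_apply] at h'
  exact h'

/-- **The bracket of two frame fields** at a point of the chart, by torsion-freeness of `∇^{LC}`:
`[e_a, e_b](x) = ∇_{e_a} e_b - ∇_{e_b} e_a`. [cite: MorganSWBook1996, §3.2] -/
theorem mlieBracket_frame_eq (i : ι) {x : X} (hx : x ∈ 𝔞.baseSet i) (a b : Fin 4) :
    mlieBracket (𝓡 4) (𝔞.frame i a) (𝔞.frame i b) x =
      g.leviCivita (𝔞.frame i b) x (𝔞.frame i a x) - g.leviCivita (𝔞.frame i a) x (𝔞.frame i b x) := by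
  have hLC : g.IsLeviCivita g.leviCivita := PseudoRiemannianMetric.isLeviCivita_leviCivita_holds
  have ht := CovariantDerivative.torsion_apply g.leviCivita (𝔞.mdifferentiableAt_frame i a hx)
    (𝔞.mdifferentiableAt_frame i b hx)
  rw [hLC.1] at ht
  have h0 : (0 : (y : X) → TangentSpace (𝓡 4) y →L[ℝ] TangentSpace (𝓡 4) y →L[ℝ] TangentSpace (𝓡 4) y) x
      (𝔞.frame i a x) (𝔞.frame i b x) = 0 := rfl
  rw [h0, eq_comm, sub_eq_zero] at ht
  exact ht.symm

/-- **`g(w(e_a), e_c) = A(a, 0, c)`**: the pairings of Taubes's vector `w(v) = (∇_v J) e₀`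
(`frameTorsionVec`) with the frame are the `b = 0` components of `∇J`. [cite: Taubes1994, §1 (1)] -/
theorem val_frameTorsionVec_frame (i : ι) {x : X} (hx : x ∈ 𝔞.baseSet i) (a c : Fin 4) :
    g.val x (𝔞.frameTorsionVec i x (𝔞.frame i a x)) (𝔞.frame i c x) =
      covJCoeffOf jIdx jSgn (𝔞.frameChristoffel i x) a 0 c := by
  rw [frameTorsionVec, map_sub, sub_apply, 𝔞.val_map_frame i hx]
  simp only [covJCoeffOf, frameChristoffel_apply, jSgn_zero, jIdx_zero, one_mul]
  ring

/-- **`w` is linear**: `w(Σ c_a v_a) = Σ c_a w(v_a)`. [folklore] -/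
theorem frameTorsionVec_sum_smul (i : ι) (x : X) {α : Type*} (t : Finset α) (c : α → ℝ)
    (w : α → TangentSpace (𝓡 4) x) :
    𝔞.frameTorsionVec i x (∑ a ∈ t, c a • w a) = ∑ a ∈ t, c a • 𝔞.frameTorsionVec i x (w a) := by
  simp only [frameTorsionVec, map_sum, map_smul, smul_sub, Finset.sum_sub_distrib]

/-! ### `ds = 0` in the adapted frame: the cyclic sum of the components of `∇J` vanishes -/

/-- **`ds = 0 ⇒ 𝔖 A(e_a, e_b, e_c) = 0`.** For a smooth closed `2`-form `s` with
`s(v, w) = g(Jv, w)` on `U_i`: in Warner's formula for `ds(e_a, e_b, e_c)` the three derivative terms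
vanish (`s(e_b, e_c) = ε_b δ_{κb, c}` is constant on `U_i`), the brackets are `∇_{e_a}e_b - ∇_{e_b}e_a`
(torsion-freeness), and the resulting identity among the `Γ`'s is — by the skewness
`Γ_{a;b,c} = -Γ_{a;c,b}` — the vanishing of the cyclic sum of `A(a,b,c) = ε_b Γ_{a;κb,c} + ε_c Γ_{a;b,κc}`
(`3 dΩ = 𝔖 ∇Ω`, `(∇_XΩ)(Y,Z) = g(Y, (∇_XJ)Z)`). [cite: FalcitelliPastoreIanus2004, Ch. 3 §3.1] -/
theorem covJCoeffOf_frameChristoffel_cyclic (i : ι) {x : X} (hx : x ∈ 𝔞.baseSet i)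
    (s : MForm (𝓡 4) X ℝ 2) (hsm : IsSmoothForm s) (hcl : IsClosedForm s)
    (hsJ : ∀ y ∈ 𝔞.baseSet i, ∀ v w : TangentSpace (𝓡 4) y, s y ![v, w] = g.val y (J y v) w)
    (a b c : Fin 4) :
    covJCoeffOf jIdx jSgn (𝔞.frameChristoffel i x) a b c + covJCoeffOf jIdx jSgn (𝔞.frameChristoffel i x) b c a +
      covJCoeffOf jIdx jSgn (𝔞.frameChristoffel i x) c a b = 0 := by
  have hα : DifferentiableWithinAt ℝ (s.inChart x) (range (𝓡 4)) (extChartAt (𝓡 4) x x) :=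
    (hsm x).differentiableWithinAt (by simp)
  -- Warner's formula on the frame fields `e_a, e_b, e_c`
  have hd := Literature.Geometry.Kaehler.mextDeriv_two_apply_vectorField (I := 𝓡 4) (F := ℝ) hα
    (Y₀ := 𝔞.frame i a) (Y₁ := 𝔞.frame i b) (Y₂ := 𝔞.frame i c)
    (𝔞.mdifferentiableAt_frame i a hx) (𝔞.mdifferentiableAt_frame i b hx) (𝔞.mdifferentiableAt_frame i c hx)
  -- `ds = 0`
  have h0 : mextDeriv s x ![𝔞.frame i a x, 𝔞.frame i b x, 𝔞.frame i c x] = 0 := by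
    rw [show mextDeriv s x = 0 from congrFun hcl x]
    rfl
  -- the derivative terms vanish: `s(e_b, e_c)` is constant on `U_i`
  have hD : ∀ a b c : Fin 4,
      mvfderiv (𝓡 4) (fun y ↦ s y ![𝔞.frame i b y, 𝔞.frame i c y]) x (𝔞.frame i a x) = 0 := by
    intro a b c
    have hconst : (fun y ↦ s y ![𝔞.frame i b y, 𝔞.frame i c y]) =ᶠ[𝓝 x]
        fun _ ↦ jSgn b * (if jIdx b = c then (1 : ℝ) else 0) := by
      filter_upwards [(𝔞.isOpen_baseSet i).mem_nhds hx] with y hy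
      rw [hsJ y hy, 𝔞.map_frame i hy b, map_smul, smul_apply, 𝔞.val_frame_frame i hy,
        smul_eq_mul]
    unfold mvfderiv
    rw [hconst.mfderiv_eq, mfderiv_const]
    rfl
  have hsw := fun a u v ↦ 𝔞.val_leviCivita_frame_swap i hx (𝔞.frame i a x) u v
  rw [h0, hD a b c, hD b a c, hD c a b] at hd
  simp only [hsJ x hx, 𝔞.val_map_frame i hx, 𝔞.mlieBracket_frame_eq i hx, map_sub,
    sub_apply] at hd
  simp only [covJCoeffOf, frameChristoffel_apply]
  linear_combination (-1 : ℝ) * hd + jSgn b * hsw a (jIdx b) c + jSgn c * hsw b (jIdx c) a +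
    jSgn a * hsw c (jIdx a) b

/-! ### Almost Kähler ⇒ quasi-Kähler at `e₀`, and Taubes's Lemma 1 -/

/-- **Almost Kähler manifolds are quasi-Kähler** (Gray–Hervella `AK ⊂ QK`), at `Y = e₀` of an
adapted frame: for a smooth closed `2`-form `s` with `s(v, w) = g(Jv, w)` on the chart, Taubes's vector
`w(v) = ∇_v e₁ - J∇_v e₀ = (∇_v J) e₀` satisfies **`w(Jv) = -J w(v)`** for every `v ∈ T_x X`, `x ∈ U_i`
— the identity `(∇_{JX} J) Y = -J (∇_X J) Y`, equivalent to `(∇_X J) Y + (∇_{JX} J) JY = 0`.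
[cite: FalcitelliPastoreIanus2004, Ch. 3 §3.1, Tables 3.1–3.2] -/
theorem frameTorsionVec_map_eq_neg_map (i : ι) {x : X} (hx : x ∈ 𝔞.baseSet i)
    (s : MForm (𝓡 4) X ℝ 2) (hsm : IsSmoothForm s) (hcl : IsClosedForm s)
    (hsJ : ∀ y ∈ 𝔞.baseSet i, ∀ v w : TangentSpace (𝓡 4) y, s y ![v, w] = g.val y (J y v) w)
    (v : TangentSpace (𝓡 4) x) :
    𝔞.frameTorsionVec i x (J x v) = -J x (𝔞.frameTorsionVec i x v) := by
  have he := 𝔞.isOrthonormalFrame_frame i hx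
  have hiii := 𝔞.covJCoeffOf_frameChristoffel_cyclic i hx s hsm hcl hsJ
  -- the identity on frame vectors, tested against the frame
  have hT : ∀ a, jSgn a • 𝔞.frameTorsionVec i x (𝔞.frame i (jIdx a) x) =
      -J x (𝔞.frameTorsionVec i x (𝔞.frame i a x)) := by
    intro a
    refine 𝔞.eq_of_val_frame_eq i hx fun c ↦ ?_
    rw [map_smul, smul_apply, smul_eq_mul, 𝔞.val_frameTorsionVec_frame i hx, map_neg,
      neg_apply, 𝔞.val_map_frame i hx, 𝔞.val_frameTorsionVec_frame i hx]
    have h := covJCoeffOf_quasiKaehler jIdx_jIdx jSgn_jIdx jSgn_mul_self (𝔞.frameChristoffel i x) hiii a 0 c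
    linear_combination h
  -- extend linearly in `v`
  calc 𝔞.frameTorsionVec i x (J x v)
      = 𝔞.frameTorsionVec i x (J x (∑ a, g.val x v (𝔞.frame i a x) • 𝔞.frame i a x)) := by
        rw [sum_val_smul_frame_eq g he v]
    _ = ∑ a, (g.val x v (𝔞.frame i a x) * jSgn a) • 𝔞.frameTorsionVec i x (𝔞.frame i (jIdx a) x) := by
        simp only [map_sum, map_smul, 𝔞.map_frame i hx, smul_smul]
        exact 𝔞.frameTorsionVec_sum_smul i x _ _ _
    _ = ∑ a, g.val x v (𝔞.frame i a x) • (-J x (𝔞.frameTorsionVec i x (𝔞.frame i a x))) := by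
        refine Finset.sum_congr rfl fun a _ ↦ ?_
        rw [← hT a, smul_smul]
    _ = -J x (𝔞.frameTorsionVec i x (∑ a, g.val x v (𝔞.frame i a x) • 𝔞.frame i a x)) := by
        rw [𝔞.frameTorsionVec_sum_smul i x, map_sum, ← Finset.sum_neg_distrib]
        simp only [map_smul, smul_neg]
    _ = -J x (𝔞.frameTorsionVec i x v) := by rw [sum_val_smul_frame_eq g he v]

/-- **Taubes's Lemma 1 (`⇒`): on a symplectic `4`-manifold with compatible `J`, `∂_{A₀} u₀ = 0`.**
For `𝔞 : AdaptedFrames g o J ι` and a smooth *closed* `2`-form `s` with `s(v, w) = g(Jv, w)` on the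
chart `U_i` (i.e. `(X, g, J, s)` almost Kähler there), the canonical spinor `u₀` is harmonic for
Taubes's connection `A₀ = 𝔞.canonicalConnection` at every `x ∈ U_i` — "The form `ω` is closed if and
only if `u₀` solves the Dirac equation" (Taubes 1994, §1, Lemma 1, p. 811; here the direction
`dω = 0 ⇒ ∂_{A₀} u₀ = 0`, through the quasi-Kähler identity and
`dirac_canonicalConnection_canonicalSpinor_eq_zero_of_quasiKaehler`). [cite: Taubes1994, §1 Lemma 1 (p. 811)] -/
theorem dirac_canonicalConnection_canonicalSpinor_eq_zero_of_isClosedForm (i : ι) {x : X}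
    (hx : x ∈ 𝔞.baseSet i) (s : MForm (𝓡 4) X ℝ 2) (hsm : IsSmoothForm s) (hcl : IsClosedForm s)
    (hsJ : ∀ y ∈ 𝔞.baseSet i, ∀ v w : TangentSpace (𝓡 4) y, s y ![v, w] = g.val y (J y v) w) :
    SpincStructure.dirac 𝔞.canonicalConnection 𝔞.canonicalSpinor i x = 0 :=
  𝔞.dirac_canonicalConnection_canonicalSpinor_eq_zero_of_quasiKaehler i hx
    fun v ↦ 𝔞.frameTorsionVec_map_eq_neg_map i hx s hsm hcl hsJ v

end LC

end Bundle

end AdaptedFrames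

end Literature.Geometry.GaugeTheory

end
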